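import Summits.Parity.GeneralizedHardyLittlewood.Theorems.LeeYangFibresAbsoluteUpgradeClipCellsScale
import Summits.Parity.GeneralizedHardyLittlewood.Theorems.LeeYangFibresAbsoluteUpgradeSingularProductLogLog
import Summits.Parity.GeneralizedHardyLittlewood.Theorems.LeeYangFibresAbsoluteUpgradeSlices
import Literature.NumberTheory.Sieve.LinearEquationsInPrimesSubsystems
import HarnessLib

/-!
# Route `LeeYangFibres`, crux `AbsoluteUpgrade` (stmt-Parity-14116), line `nlc-cells-absolute-clip`:
# the registered stub `stub_clipCells` (the clipping assembly)

The one-scale mathematics is in `…ClipCellsWalsh` (`clipCells_marginal`), `…ClipCellsAux`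
(`clipCells_identityForm`, `walsh_corner_clip`) and `…ClipCellsScale` (`clipCells_lowMass`, `highMass_bound`);
this file assembles it along the slowly divergent roughness `u(N) ≍ log log log N`:
* `clipCells_pair` — one scale, one pair `(Ψ, K)`: `highMass_bound` (mass `≥ η₀ N`, after `clipCells_marginal`
  and division of the anatomy by `N`) or `clipCells_lowMass` (mass `< η₀ N`);
* `clipCells_smallParams`, `clipCells_roughness`, `clipCells_growth` — the `N`-free small parameters, the
  roughness `u = ⌈((t−1) log₃ N + R)/κ⌉ ∈ [4, A log₃ N]` with `e^{−κu}(2C_σ+1)(log log N)^{t−1} ≤ D`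
  (`coeff_mul_exp_le`), and the growth conditions in `N` (`(log log N)^{t−1} = o(log N)`);
* `stub_clipCells` — the constants in order (`κ = min(c, c')`, `A = t/κ + 1`, then `C_s, C₁, c_an, c₀, C_W`,
  the small parameters, the thresholds) and the mass ceiling `β_∞ ∏_p β_p ≤ (2C_σ+1)(log log N)^{t−1} N`
  (`stub_singularProduct_le_loglog_pow`, `archFactor_le_two_mul`).
-/

noncomputable section

open scoped BigOperators
open Finset Filter

namespace Summit.Parity.GeneralizedHardyLittlewood.Theorems.AbsoluteUpgrade

open Literature.NumberTheory.Sieve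
open Summit.Parity.GeneralizedHardyLittlewood.Cruxes.AbsoluteUpgrade.NlcCellsAbsoluteClip

/-! ## One scale, one pair `(Ψ, K)` -/

/-- **The clipping assembly at one scale and one pair.**  At a scale `N ≥ 1` (`log N ≥ 1`,
`N^{1/u} ≥ max(2, 2L)`), a roughness `u ≥ 4` and an admissible pair `(Ψ, K)` of singular mass
`0 ≤ M = β_∞ ∏_p β_p ≤ B N`: the cell law (amplitudes `θ`, accuracy `ε_law N/log^t N` on `[1,u]^t`), corner
NLC above the mass threshold `η₀ N`, the singles bound over the rough tuples, the parity balance of the rough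
integers and the rough anatomy give, under the bookkeeping hypotheses of `highMass_bound` and
`(2^{t+1}+1) η₀ 2^t ≤ ε/2`, the prime corner cell absolutely: `|C_𝟙 − M (A_1/N)^t| ≤ ε N/log^t N`. [folklore] -/
theorem clipCells_pair {t L N u : ℕ} (Ψ : Fin t → AffLinForm 1) (K : Set (Fin 1 → ℝ))
    {c₀ C_W C_s C₁ c_an η₀ η ε ε' ε_law B D D' E E₁ : ℝ}
    (hN : 1 ≤ N) (hu : 4 ≤ u) (hℓ : 1 ≤ Real.log N) (hL : affLinSize Ψ N ≤ L)
    (hz2 : (2 : ℝ) ≤ (N : ℝ) ^ ((1 : ℝ) / u)) (hzL : (2 * L : ℝ) ≤ (N : ℝ) ^ ((1 : ℝ) / u))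
    (hCW : 0 ≤ C_W)
    (hW : ∀ (θ : Finset (Fin t) → ℝ) (c : (Fin t → ℕ) → ℝ) (δ η τ : ℝ),
      0 ≤ δ → 0 ≤ η → 0 ≤ τ → δ + η + τ ≤ c₀ →
      θ ∅ = 1 → (∀ S, |θ S| ≤ 2) → (∀ i : Fin t, |θ {i}| ≤ τ) →
      (∀ j, IsCorner j → 0 ≤ c j ∧ |c j - walshForm θ j| ≤ δ) →
      (∀ j j', IsCorner j → IsCorner j' → c (j ⊔ j') * c (j ⊓ j') ≤ c j * c j' + η) →
        |walshForm θ (fun _ => 1) - 1| ≤ C_W * (δ + η + τ))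
    (θ : Finset (Fin t) → ℝ) (hθ0 : θ ∅ = 1) (hθ2 : ∀ S, |θ S| ≤ 2)
    (hlaw : ∀ j : Fin t → ℕ, (∀ i, 1 ≤ j i ∧ j i ≤ u) →
      |(jointCell Ψ K N u j : ℝ) - walshForm θ j * modelCell Ψ K N u j| ≤ ε_law * N / Real.log N ^ t)
    (hnlc : η₀ * N ≤ archFactor Ψ K * singularProduct Ψ → ∀ j j' : Fin t → ℕ, IsCorner j →
      IsCorner j' → (jointCell Ψ K N u (j ⊔ j') : ℝ) * jointCell Ψ K N u (j ⊓ j') ≤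
        (jointCell Ψ K N u j : ℝ) * jointCell Ψ K N u j' +
          η * (archFactor Ψ K * singularProduct Ψ / N) * ((N : ℝ) / Real.log N ^ t) ^ 2)
    (hsing : ∀ i : Fin t,
      |∑ n ∈ roughTuples Ψ K N u, (-1 : ℝ) ^ (ArithmeticFunction.cardFactors ((Ψ i).eval n).toNat)| ≤
        C_s * E * (archFactor Ψ K * singularProduct Ψ) * ((u : ℝ) / Real.log N) ^ t +
          (N : ℝ) / Real.log N ^ (t + 1))
    (hbal : |∑ m ∈ Icc 1 u, (-1 : ℝ) ^ m * (roughCell N u m : ℝ)| ≤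
      C₁ * E₁ * N * ((u : ℝ) / Real.log N) + N / Real.log N ^ 2)
    (hcorner : ∀ m ∈ ({1, 2, 3} : Finset ℕ), c_an * N / Real.log N ≤ (roughCell N u m : ℝ))
    (ha1 : (roughCell N u 1 : ℝ) ≤ 2 * N / Real.log N)
    (hsum : c_an * u * N / Real.log N ≤ ∑ m ∈ Icc 1 u, (roughCell N u m : ℝ))
    (hM0 : 0 ≤ archFactor Ψ K * singularProduct Ψ) (hMB : archFactor Ψ K * singularProduct Ψ ≤ B * N)
    (hη₀ : 0 < η₀) (hc_an : 0 < c_an) (hε_law : 0 ≤ ε_law) (hη : 0 ≤ η) (hC_s : 0 ≤ C_s)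
    (hC₁ : 0 ≤ C₁) (hE : 0 ≤ E) (hE₁ : 0 ≤ E₁)
    (hED : E * B ≤ D) (hE₁D : E₁ * B ≤ D) (hED' : E ≤ D') (hE₁D' : E₁ ≤ D')
    (s₁ : 2 * ε_law / c_an ^ t ≤ ε') (s₂ : η / c_an ^ (2 * t) ≤ ε') (s₃ : C_s * D / c_an ^ t ≤ ε')
    (s₄ : 1 / (c_an ^ t * Real.log N) ≤ ε') (s₅ : 2 ^ (t + 1) * C₁ * D / c_an ≤ ε')
    (s₆ : 2 ^ (t + 1) * B / (4 * c_an * Real.log N) ≤ ε')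
    (hε' : 6 * ε' * (C_W * 2 ^ t) ≤ ε / 2) (hε_law2 : ε_law ≤ ε / 2)
    (r₁ : ε_law / (η₀ * c_an ^ t) ≤ c₀ / 12) (r₂ : η / (η₀ * c_an ^ (2 * t)) ≤ c₀ / 6)
    (r₃ : C_s * D' / c_an ^ t ≤ c₀ / 6) (r₄ : 1 / (η₀ * c_an ^ t * Real.log N) ≤ c₀ / 6)
    (r₅ : 2 ^ (t + 1) * C₁ * D' / c_an ≤ c₀ / 6) (r₆ : 2 ^ (t + 1) / (4 * c_an * Real.log N) ≤ c₀ / 6)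
    (hlow : (2 ^ (t + 1) + 1) * η₀ * 2 ^ t ≤ ε / 2) :
    |(jointCell Ψ K N u (fun _ => 1) : ℝ) - modelCell Ψ K N u (fun _ => 1)| ≤ ε * N / Real.log N ^ t := by
  have hN0 : (0 : ℝ) < N := Nat.cast_pos.mpr (by omega)
  have hu1 : 1 ≤ u := by omega
  -- the model and the law at the prime corner
  have hmodel1 : modelCell Ψ K N u (fun _ => 1) =
      archFactor Ψ K * singularProduct Ψ * ((roughCell N u 1 : ℝ) / N) ^ t := by
    unfold modelCell
    rw [prod_const, card_univ, Fintype.card_fin]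
  have hlaw1 : |(jointCell Ψ K N u (fun _ => 1) : ℝ) - walshForm θ (fun _ => 1) *
      (archFactor Ψ K * singularProduct Ψ * ((roughCell N u 1 : ℝ) / N) ^ t)| ≤
        ε_law * N / Real.log N ^ t := by
    rw [← hmodel1]
    exact hlaw _ fun _ => ⟨le_rfl, hu1⟩
  have ha10 : 0 ≤ (roughCell N u 1 : ℝ) / N := by positivity
  have ha1' : (roughCell N u 1 : ℝ) / N ≤ 2 / Real.log N := by
    rw [div_le_iff₀ hN0, div_mul_eq_mul_div]
    exact ha1
  rw [hmodel1]
  by_cases hhigh : η₀ * N ≤ archFactor Ψ K * singularProduct Ψ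
  · -- high mass: `highMass_bound` for `C_j = jointCell Ψ K N u j`, `a_m = A_m(N)/N`
    have hcorner' : ∀ m ∈ ({1, 2, 3} : Finset ℕ), c_an / Real.log N ≤ (roughCell N u m : ℝ) / N :=
      fun m hm => by rw [le_div_iff₀ hN0, div_mul_eq_mul_div]; exact hcorner m hm
    have hsum' : c_an * u / Real.log N ≤ ∑ m ∈ Icc 1 u, (roughCell N u m : ℝ) / N := by
      rw [← sum_div, le_div_iff₀ hN0, div_mul_eq_mul_div]
      exact hsum
    have hlaw' : ∀ j ∈ Fintype.piFinset (fun _ : Fin t => Icc 1 u),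
        |(jointCell Ψ K N u j : ℝ) - walshForm θ j *
          (archFactor Ψ K * singularProduct Ψ * ∏ k, (roughCell N u (j k) : ℝ) / N)| ≤
            ε_law * N / Real.log N ^ t :=
      fun j hj => hlaw j fun i => mem_Icc.mp (Fintype.mem_piFinset.mp hj i)
    have hsing' : ∀ i : Fin t,
        |∑ j ∈ Fintype.piFinset (fun _ : Fin t => Icc 1 u), (-1 : ℝ) ^ (j i) * (jointCell Ψ K N u j : ℝ)| ≤
          C_s * E * (archFactor Ψ K * singularProduct Ψ) * ((u : ℝ) / Real.log N) ^ t +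
            N / Real.log N ^ (t + 1) :=
      fun i => by rw [← clipCells_marginal Ψ K hN hu1 hL hz2 hzL i]; exact hsing i
    have hbal' : |∑ m ∈ Icc 1 u, (-1 : ℝ) ^ m * ((roughCell N u m : ℝ) / N)| ≤
        C₁ * E₁ * ((u : ℝ) / Real.log N) + 1 / Real.log N ^ 2 := by
      have h1 : ∑ m ∈ Icc 1 u, (-1 : ℝ) ^ m * ((roughCell N u m : ℝ) / N) =
          (∑ m ∈ Icc 1 u, (-1 : ℝ) ^ m * (roughCell N u m : ℝ)) / N := by
        rw [sum_div]
        exact sum_congr rfl fun m _ => by ring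
      rw [h1, abs_div, abs_of_pos hN0, div_le_iff₀ hN0]
      calc |∑ m ∈ Icc 1 u, (-1 : ℝ) ^ m * (roughCell N u m : ℝ)|
          ≤ C₁ * E₁ * N * ((u : ℝ) / Real.log N) + N / Real.log N ^ 2 := hbal
        _ = (C₁ * E₁ * ((u : ℝ) / Real.log N) + 1 / Real.log N ^ 2) * N := by ring
    exact highMass_bound hu hCW hW θ hθ0 hθ2 (fun j => (jointCell Ψ K N u j : ℝ))
      (fun j => Nat.cast_nonneg _) (fun m => (roughCell N u m : ℝ) / N) (fun m => by positivity) hN0 hℓ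
      hη₀ hhigh hMB hc_an hε_law hη hC_s hC₁ hE hE₁ hED hE₁D hED' hE₁D' hcorner' ha1' hsum' hlaw'
      (hnlc hhigh) hsing' hbal' s₁ s₂ s₃ s₄ s₅ s₆ hε' hε_law2 r₁ r₂ r₃ r₄ r₅ r₆
  · -- low mass: the law alone (`clipCells_lowMass`)
    push Not at hhigh
    have hMm0 : 0 ≤ archFactor Ψ K * singularProduct Ψ * ((roughCell N u 1 : ℝ) / N) ^ t :=
      mul_nonneg hM0 (pow_nonneg ha10 t)
    refine (clipCells_lowMass θ hθ2 hMm0 hlaw1).trans ?_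
    have h2 : archFactor Ψ K * singularProduct Ψ * ((roughCell N u 1 : ℝ) / N) ^ t ≤
        η₀ * N * (2 / Real.log N) ^ t :=
      mul_le_mul hhigh.le (pow_le_pow_left₀ ha10 ha1' t) (pow_nonneg ha10 t) (by positivity)
    calc ε_law * N / Real.log N ^ t +
        (2 ^ (t + 1) + 1) * (archFactor Ψ K * singularProduct Ψ * ((roughCell N u 1 : ℝ) / N) ^ t)
        ≤ ε / 2 * N / Real.log N ^ t + (2 ^ (t + 1) + 1) * (η₀ * N * (2 / Real.log N) ^ t) :=
          add_le_add (div_le_div_of_nonneg_right (mul_le_mul_of_nonneg_right hε_law2 hN0.le)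
            (by positivity)) (mul_le_mul_of_nonneg_left h2 (by positivity))
      _ = ε / 2 * N / Real.log N ^ t + (2 ^ (t + 1) + 1) * η₀ * 2 ^ t * N / Real.log N ^ t := by
          rw [div_pow]
          ring
      _ ≤ ε / 2 * N / Real.log N ^ t + ε / 2 * N / Real.log N ^ t :=
          add_le_add le_rfl (div_le_div_of_nonneg_right (mul_le_mul_of_nonneg_right hlow hN0.le)
            (by positivity))
      _ = ε * N / Real.log N ^ t := by ring

/-! ## The parameters -/

/-- **The small parameters.**  Given `ε, c₀ > 0`, `C_W, C_s, C₁ ≥ 0`, `c_an > 0`, there are positive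
`η₀ = ε/(2·2^t(2^{t+1}+1))`, `ε' = ε/(12(C_W 2^t+1))`, `D`, `ε_law`, `η` satisfying the eleven
`N`-free smallness conditions of `highMass_bound` / `clipCells_pair`. [folklore] -/
theorem clipCells_smallParams (t : ℕ) {ε c₀ C_W C_s C₁ c_an : ℝ} (hε : 0 < ε) (hc₀ : 0 < c₀)
    (hCW : 0 ≤ C_W) (hC_s : 0 ≤ C_s) (hC₁ : 0 ≤ C₁) (hc_an : 0 < c_an) :
    ∃ η₀ ε' D ε_law η : ℝ, 0 < η₀ ∧ 0 < ε' ∧ 0 < D ∧ 0 < ε_law ∧ 0 < η ∧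
      2 * ε_law / c_an ^ t ≤ ε' ∧ η / c_an ^ (2 * t) ≤ ε' ∧ C_s * D / c_an ^ t ≤ ε' ∧
      2 ^ (t + 1) * C₁ * D / c_an ≤ ε' ∧ 6 * ε' * (C_W * 2 ^ t) ≤ ε / 2 ∧ ε_law ≤ ε / 2 ∧
      ε_law / (η₀ * c_an ^ t) ≤ c₀ / 12 ∧ η / (η₀ * c_an ^ (2 * t)) ≤ c₀ / 6 ∧
      C_s * D / c_an ^ t ≤ c₀ / 6 ∧ 2 ^ (t + 1) * C₁ * D / c_an ≤ c₀ / 6 ∧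
      (2 ^ (t + 1) + 1) * η₀ * 2 ^ t ≤ ε / 2 := by
  have hct : 0 < c_an ^ t := pow_pos hc_an t
  -- `η₀`, `ε'`
  obtain ⟨η₀, hη₀def⟩ : ∃ η₀ : ℝ, η₀ = ε / (2 * 2 ^ t * (2 ^ (t + 1) + 1)) := ⟨_, rfl⟩
  have hη₀ : 0 < η₀ := by rw [hη₀def]; positivity
  have hlowc : (2 ^ (t + 1) + 1) * η₀ * 2 ^ t ≤ ε / 2 :=
    (by rw [hη₀def]; field_simp : (2 ^ (t + 1) + 1) * η₀ * 2 ^ t = ε / 2).le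
  obtain ⟨ε', hε'def⟩ : ∃ ε' : ℝ, ε' = ε / (12 * (C_W * 2 ^ t + 1)) := ⟨_, rfl⟩
  have hε'0 : 0 < ε' := by rw [hε'def]; positivity
  have hε'c : 6 * ε' * (C_W * 2 ^ t) ≤ ε / 2 := by
    have h1 : ε' * (C_W * 2 ^ t + 1) = ε / 12 := by rw [hε'def]; field_simp
    rw [(by linear_combination 6 * h1 : 6 * ε' * (C_W * 2 ^ t) = ε / 2 - 6 * ε')]
    linarith
  -- `D`
  obtain ⟨μ, hμε', hμc₀, hμ0⟩ : ∃ μ : ℝ, μ ≤ ε' ∧ μ ≤ c₀ / 6 ∧ 0 < μ :=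
    ⟨min ε' (c₀ / 6), min_le_left _ _, min_le_right _ _, lt_min hε'0 (by positivity)⟩
  obtain ⟨D, hD1, hD2, hD0⟩ : ∃ D : ℝ, D * (C_s + 1) ≤ μ * c_an ^ t ∧
      D * (2 ^ (t + 1) * (C₁ + 1)) ≤ μ * c_an ∧ 0 < D := by
    refine ⟨min (μ * c_an ^ t / (C_s + 1)) (μ * c_an / (2 ^ (t + 1) * (C₁ + 1))), ?_, ?_,
      lt_min (by positivity) (by positivity)⟩
    · rw [← le_div_iff₀ (by positivity : (0 : ℝ) < C_s + 1)]
      exact min_le_left _ _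
    · rw [← le_div_iff₀ (by positivity : (0 : ℝ) < 2 ^ (t + 1) * (C₁ + 1))]
      exact min_le_right _ _
  have hD1' : C_s * D ≤ μ * c_an ^ t := by
    linarith [hD0.le, (by ring : D * (C_s + 1) = C_s * D + D)]
  have hD2' : 2 ^ (t + 1) * C₁ * D ≤ μ * c_an := by
    have h0 : 0 ≤ 2 ^ (t + 1) * D := by positivity
    linarith [(by ring : D * (2 ^ (t + 1) * (C₁ + 1)) = 2 ^ (t + 1) * C₁ * D + 2 ^ (t + 1) * D)]
  -- `ε_law`, `η`
  obtain ⟨ε_law, hεl1, hεl2, hεl3, hε_law⟩ : ∃ ε_law : ℝ, 2 * ε_law ≤ ε' * c_an ^ t ∧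
      ε_law ≤ ε / 2 ∧ ε_law ≤ c₀ / 12 * (η₀ * c_an ^ t) ∧ 0 < ε_law := by
    refine ⟨min (ε' * c_an ^ t / 2) (min (ε / 2) (c₀ / 12 * (η₀ * c_an ^ t))), ?_,
      (min_le_right _ _).trans (min_le_left _ _), (min_le_right _ _).trans (min_le_right _ _),
      lt_min (by positivity) (lt_min (by positivity) (by positivity))⟩
    have := min_le_left (ε' * c_an ^ t / 2) (min (ε / 2) (c₀ / 12 * (η₀ * c_an ^ t)))
    linarith
  obtain ⟨η, hη1, hη2, hη⟩ : ∃ η : ℝ, η ≤ ε' * c_an ^ (2 * t) ∧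
      η ≤ c₀ / 6 * (η₀ * c_an ^ (2 * t)) ∧ 0 < η :=
    ⟨min (ε' * c_an ^ (2 * t)) (c₀ / 6 * (η₀ * c_an ^ (2 * t))), min_le_left _ _, min_le_right _ _,
      lt_min (by positivity) (by positivity)⟩
  refine ⟨η₀, ε', D, ε_law, η, hη₀, hε'0, hD0, hε_law, hη, ?_, ?_, ?_, ?_, hε'c, hεl2, ?_, ?_, ?_, ?_,
    hlowc⟩
  · rw [div_le_iff₀ hct]; exact hεl1
  · rw [div_le_iff₀ (by positivity)]; exact hη1
  · rw [div_le_iff₀ hct]; exact hD1'.trans (mul_le_mul_of_nonneg_right hμε' hct.le)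
  · rw [div_le_iff₀ hc_an]; exact hD2'.trans (mul_le_mul_of_nonneg_right hμε' hc_an.le)
  · rw [div_le_iff₀ (by positivity)]; exact hεl3
  · rw [div_le_iff₀ (by positivity)]; exact hη2
  · rw [div_le_iff₀ hct]; exact hD1'.trans (mul_le_mul_of_nonneg_right hμc₀ hct.le)
  · rw [div_le_iff₀ hc_an]; exact hD2'.trans (mul_le_mul_of_nonneg_right hμc₀ hc_an.le)

/-- **The roughness at one scale.**  With `κ ≤ min(c, c')`, `B₀ ≥ 1`, `D > 0`, `R ≥ max(log(B₀/D), 4κ)`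
and `G ≥ 1` (`G = log log N`) with `log G ≥ max(R, 1)`: the roughness `u = ⌈(n log G + R)/κ⌉` satisfies
`4 ≤ u ≤ ((n+1)/κ + 1) log G` and `e^{−xu} B₀ G^n ≤ D`, `e^{−xu} ≤ D` for every rate `x ≥ κ`
(`coeff_mul_exp_le`). [folklore] -/
theorem clipCells_roughness (n : ℕ) {κ B₀ D R G : ℝ} (hκ0 : 0 < κ) (hB₀0 : 0 < B₀) (hB₀1 : 1 ≤ B₀)
    (hD0 : 0 < D) (hRD : Real.log (B₀ / D) ≤ R) (hRκ : 4 * κ ≤ R) (hG1 : 1 ≤ G) (hRG : R ≤ Real.log G)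
    (h1G : 1 ≤ Real.log G) :
    ∃ u : ℕ, 4 ≤ u ∧ (u : ℝ) ≤ (((n : ℝ) + 1) / κ + 1) * Real.log G ∧
      ∀ x : ℝ, κ ≤ x → Real.exp (-(x * u)) * (B₀ * G ^ n) ≤ D ∧ Real.exp (-(x * u)) ≤ D := by
  have hG0 : 0 < G := by linarith
  have htl : 0 ≤ (n : ℝ) * Real.log G := mul_nonneg (Nat.cast_nonneg _) (by linarith)
  obtain ⟨Λ, hΛdef⟩ : ∃ Λ : ℝ, Λ = (n : ℝ) * Real.log G + R := ⟨_, rfl⟩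
  have hΛ0 : 0 ≤ Λ := by rw [hΛdef]; linarith
  obtain ⟨u, hudef⟩ : ∃ u : ℕ, u = ⌈Λ / κ⌉₊ := ⟨_, rfl⟩
  have hu0 : (0 : ℝ) ≤ u := Nat.cast_nonneg u
  have huΛ : Λ ≤ κ * u := by
    have h := Nat.le_ceil (Λ / κ)
    rw [← hudef, div_le_iff₀ hκ0] at h
    linarith
  have hu4 : 4 ≤ u := by
    have h1 : κ * 4 ≤ κ * u := by rw [hΛdef] at huΛ; linarith
    have h2 : (4 : ℝ) ≤ u := le_of_mul_le_mul_left h1 hκ0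
    exact_mod_cast h2
  have huA : (u : ℝ) ≤ (((n : ℝ) + 1) / κ + 1) * Real.log G := by
    have h1 : (u : ℝ) < Λ / κ + 1 := by rw [hudef]; exact Nat.ceil_lt_add_one (div_nonneg hΛ0 hκ0.le)
    have h2 : Λ ≤ ((n : ℝ) + 1) * Real.log G := by rw [hΛdef]; linarith
    have h3 := div_le_div_of_nonneg_right h2 hκ0.le
    calc (u : ℝ) ≤ Λ / κ + 1 := h1.le
      _ ≤ ((n : ℝ) + 1) * Real.log G / κ + Real.log G := by linarith
      _ = (((n : ℝ) + 1) / κ + 1) * Real.log G := by ring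
  -- the decay at `u`
  have hB1 : 1 ≤ B₀ * G ^ n := one_le_mul_of_one_le_of_one_le hB₀1 (one_le_pow₀ hG1)
  have hBpos : 0 < B₀ * G ^ n := by positivity
  have hdecay : B₀ * G ^ n * Real.exp (-Λ) ≤ D := by
    refine coeff_mul_exp_le le_rfl hBpos hD0 ?_
    have h : Real.log (B₀ * G ^ n / D) = Real.log (B₀ / D) + (n : ℝ) * Real.log G := by
      rw [mul_div_right_comm, Real.log_mul (div_pos hB₀0 hD0).ne' (pow_pos hG0 _).ne', Real.log_pow]
    rw [h, hΛdef]
    linarith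
  refine ⟨u, hu4, huA, fun x hx => ?_⟩
  have hE : Real.exp (-(x * u)) ≤ Real.exp (-Λ) := by
    have := mul_le_mul_of_nonneg_right hx hu0
    exact Real.exp_le_exp.mpr (by linarith)
  have hED : Real.exp (-(x * u)) * (B₀ * G ^ n) ≤ D :=
    calc Real.exp (-(x * u)) * (B₀ * G ^ n) ≤ Real.exp (-Λ) * (B₀ * G ^ n) :=
          mul_le_mul_of_nonneg_right hE hBpos.le
      _ = B₀ * G ^ n * Real.exp (-Λ) := mul_comm _ _
      _ ≤ D := hdecay
  exact ⟨hED, (le_mul_of_one_le_right (Real.exp_pos _).le hB1).trans hED⟩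

/-- **The growth conditions in `N`.**  For all large `N`: `N ≥ 1`, `log N ≥ ℓ₀`, `log log N ≥ 1`,
`log log log N ≥ R` and `K (log log N)^n ≤ log N` (`(log y)^n = o(y)` at `y = log N`). [folklore] -/
theorem clipCells_growth (n : ℕ) (K R ℓ₀ : ℝ) : ∀ᶠ N : ℕ in atTop,
    (1 : ℝ) ≤ N ∧ ℓ₀ ≤ Real.log N ∧ 1 ≤ Real.log (Real.log N) ∧
      R ≤ Real.log (Real.log (Real.log N)) ∧ K * Real.log (Real.log N) ^ n ≤ Real.log N := by
  have hl : Tendsto (fun N : ℕ => Real.log (N : ℝ)) atTop atTop :=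
    Real.tendsto_log_atTop.comp tendsto_natCast_atTop_atTop
  have hll : Tendsto (fun N : ℕ => Real.log (Real.log (N : ℝ))) atTop atTop :=
    Real.tendsto_log_atTop.comp hl
  -- `K (log y)^n ≤ y` for large real `y`
  have hK : ∀ᶠ y : ℝ in atTop, K * Real.log y ^ n ≤ y := by
    have h := (Real.isLittleO_pow_log_id_atTop (n := n)).bound
      (show (0 : ℝ) < 1 / (|K| + 1) by positivity)
    filter_upwards [h, eventually_ge_atTop (1 : ℝ)] with y hy hy1
    have hlog0 : 0 ≤ Real.log y ^ n := pow_nonneg (Real.log_nonneg hy1) n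
    rw [id, Real.norm_eq_abs, Real.norm_eq_abs, abs_of_nonneg hlog0,
      abs_of_nonneg (by linarith : (0 : ℝ) ≤ y)] at hy
    have h1 : (|K| + 1) * Real.log y ^ n ≤ y := by
      have := mul_le_mul_of_nonneg_left hy (show (0 : ℝ) ≤ |K| + 1 by positivity)
      rwa [← mul_assoc, mul_one_div_cancel (by positivity : (|K| : ℝ) + 1 ≠ 0), one_mul] at this
    have h2 : K * Real.log y ^ n ≤ (|K| + 1) * Real.log y ^ n :=
      mul_le_mul_of_nonneg_right ((le_abs_self K).trans (by linarith)) hlog0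
    linarith
  exact (tendsto_natCast_atTop_atTop.eventually_ge_atTop 1).and ((hl.eventually_ge_atTop ℓ₀).and
    ((hll.eventually_ge_atTop 1).and (((Real.tendsto_log_atTop.comp hll).eventually_ge_atTop R).and
    (hl.eventually hK))))

/-! ## The registered stub -/

/-- **`stub_clipCells` (registered stub of the line `nlc-cells-absolute-clip`) — the clipping assembly.**
Given `t, L, ε`: `κ = min(c, c')` from `SinglesDecay` (at `(t, L)`, and at `(1, 1)` through
`clipCells_identityForm`), `A = t/κ + 1`; the constants `C_s, C₁, c_an, c₀, C_W` at `A`; the small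
parameters (`clipCells_smallParams`); the thresholds of the law (at `ε_law`) and of corner NLC (at `η₀, η`);
the growth conditions (`clipCells_growth`); and at each large `N` the roughness `u(N)` of `clipCells_roughness`,
whose decay `e^{−κ u}(2C_σ + 1)(log log N)^{t−1} ≤ D` beats the mass ceiling
`β_∞ ∏_p β_p ≤ (2C_σ+1)(log log N)^{t−1} N` (`stub_singularProduct_le_loglog_pow`, `archFactor_le_two_mul`).
Then `clipCells_pair` at every admissible pair. [folklore] -/
theorem stub_clipCells : CellParityLawLog3 → CellNLC → SinglesDecay → WalshClipping → RoughAnatomy → PrimeCellsAbsolute := by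
  intro hlaw hnlc hsing hW hanat t L ht ε hε
  -- decay rates, the singular-product ceiling, the slope `A` of the slow range
  obtain ⟨c, hc, hsingA⟩ := hsing t L ht
  obtain ⟨c', hc', hidA⟩ := clipCells_identityForm hsing
  obtain ⟨Cσ, hCσ, Nσ, hσ⟩ := stub_singularProduct_le_loglog_pow t L ht
  obtain ⟨κ, hκc, hκc', hκ0⟩ : ∃ κ : ℝ, κ ≤ c ∧ κ ≤ c' ∧ 0 < κ :=
    ⟨min c c', min_le_left _ _, min_le_right _ _, lt_min hc hc'⟩
  obtain ⟨B₀, hB₀2, hB₀0, hB₀1⟩ : ∃ B₀ : ℝ, 2 * Cσ ≤ B₀ ∧ 0 < B₀ ∧ 1 ≤ B₀ :=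
    ⟨2 * Cσ + 1, (lt_add_one _).le, by positivity, le_add_of_nonneg_left (by positivity)⟩
  obtain ⟨A, hAdef⟩ : ∃ A : ℝ, A = (((t - 1 : ℕ) : ℝ) + 1) / κ + 1 := ⟨_, rfl⟩
  -- the constants at `A` and the small parameters
  obtain ⟨C_s', N_s, hsN⟩ := hsingA A
  obtain ⟨C₁, hC₁, N₁, hidN⟩ := hidA A
  obtain ⟨c_an, hc_an, N_an, hanN⟩ := hanat A
  obtain ⟨c₀, hc₀, C_W, hWt⟩ := hW t
  obtain ⟨C_s, hCs_le, hC_s⟩ : ∃ C_s : ℝ, C_s' ≤ C_s ∧ 0 ≤ C_s :=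
    ⟨max C_s' 0, le_max_left _ _, le_max_right _ _⟩
  have hct : 0 < c_an ^ t := pow_pos hc_an t
  obtain ⟨η₀, ε', D, ε_law, η, hη₀, hε'0, hD0, hε_law, hη, s₁, s₂, s₃, s₅, hε'c, hεl2, r₁, r₂, r₃,
    r₅, hlowc⟩ := clipCells_smallParams t hε hc₀ (le_max_right C_W 0) hC_s hC₁ hc_an
  -- the thresholds in `N`
  obtain ⟨N_law, hlawN⟩ := hlaw t L ht A ε_law hε_law
  obtain ⟨N_nlc, hnlcN⟩ := hnlc t L ht A η₀ hη₀ η hη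
  obtain ⟨N_z, hzN⟩ := exists_forall_le_rpow_inv A (max 2 (2 * L))
  obtain ⟨R, hRD, hRκ⟩ : ∃ R : ℝ, Real.log (B₀ / D) ≤ R ∧ 4 * κ ≤ R :=
    ⟨max (Real.log (B₀ / D)) (4 * κ), le_max_left _ _, le_max_right _ _⟩
  obtain ⟨ℓ₀, hℓ₀1, hℓ₀2, hℓ₀3, hℓ₀4⟩ : ∃ ℓ₀ : ℝ, 1 ≤ ℓ₀ ∧ 1 / (c_an ^ t * ε') ≤ ℓ₀ ∧
      1 / (η₀ * c_an ^ t * (c₀ / 6)) ≤ ℓ₀ ∧ 2 ^ (t + 1) / (4 * c_an * (c₀ / 6)) ≤ ℓ₀ :=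
    ⟨max 1 (max (1 / (c_an ^ t * ε')) (max (1 / (η₀ * c_an ^ t * (c₀ / 6)))
      (2 ^ (t + 1) / (4 * c_an * (c₀ / 6))))), le_max_left _ _,
      (le_max_left _ _).trans (le_max_right _ _),
      ((le_max_left _ _).trans (le_max_right _ _)).trans (le_max_right _ _),
      ((le_max_right _ _).trans (le_max_right _ _)).trans (le_max_right _ _)⟩
  obtain ⟨Kc, hKc⟩ : ∃ Kc : ℝ, Kc = 2 ^ (t + 1) * B₀ / (4 * c_an * ε') := ⟨_, rfl⟩
  obtain ⟨N₀, hN₀⟩ := eventually_atTop.mp ((eventually_ge_atTop Nσ).and ((eventually_ge_atTop N_s).and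
    ((eventually_ge_atTop N₁).and ((eventually_ge_atTop N_an).and ((eventually_ge_atTop N_law).and
    ((eventually_ge_atTop N_nlc).and ((eventually_ge_atTop N_z).and
    (clipCells_growth (t - 1) Kc (max R 1) ℓ₀))))))))
  refine ⟨N₀, fun N hN => ?_⟩
  obtain ⟨hNσ, hNs, hN1', hNan, hNlaw, hNnlc, hNz, hN1r, hℓ₀N, hG1, hlogG, hKG⟩ := hN₀ N hN
  -- the scale `N` and its roughness `u`
  have hN1 : 1 ≤ N := by exact_mod_cast hN1r
  have hN0 : (0 : ℝ) < N := by exact_mod_cast hN1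
  have hℓ1 : 1 ≤ Real.log N := hℓ₀1.trans hℓ₀N
  have hℓ0 : 0 < Real.log N := one_pos.trans_le hℓ1
  obtain ⟨u, hu4, huA', hdec⟩ := clipCells_roughness (t - 1) hκ0 hB₀0 hB₀1 hD0 hRD hRκ hG1
    ((le_max_left _ _).trans hlogG) ((le_max_right _ _).trans hlogG)
  have huA : (u : ℝ) ≤ A * Real.log (Real.log (Real.log N)) := by rw [hAdef]; exact huA'
  have hu1 : 1 ≤ u := by omega
  have hu0 : (0 : ℝ) ≤ u := Nat.cast_nonneg u
  -- the `1/log N` conditions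
  have s₄ : 1 / (c_an ^ t * Real.log N) ≤ ε' := div_mul_le_of_le hct hε'0 hℓ0 (hℓ₀2.trans hℓ₀N)
  have r₄ : 1 / (η₀ * c_an ^ t * Real.log N) ≤ c₀ / 6 :=
    div_mul_le_of_le (by positivity) (by positivity) hℓ0 (hℓ₀3.trans hℓ₀N)
  have r₆ : 2 ^ (t + 1) / (4 * c_an * Real.log N) ≤ c₀ / 6 :=
    div_mul_le_of_le (by positivity) (by positivity) hℓ0 (hℓ₀4.trans hℓ₀N)
  have s₆ : 2 ^ (t + 1) * (B₀ * Real.log (Real.log N) ^ (t - 1)) / (4 * c_an * Real.log N) ≤ ε' := by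
    refine div_mul_le_of_le (by positivity) hε'0 hℓ0 ?_
    calc 2 ^ (t + 1) * (B₀ * Real.log (Real.log N) ^ (t - 1)) / (4 * c_an * ε')
        = Kc * Real.log (Real.log N) ^ (t - 1) := by rw [hKc]; ring
      _ ≤ Real.log N := hKG
  -- the sieving limit, the anatomy and the parity balance at `(N, u)`
  have hz := hzN N hNz u hu1 huA
  obtain ⟨hcorner, ha1, hsum⟩ := hanN N hNan u hu4 huA
  -- every admissible pair
  refine ⟨u, by omega, fun Ψ hΨ hL K hK hKN => ?_⟩
  have hS0 : 0 ≤ singularProduct Ψ := ge_of_tendsto' (tendsto_singularProductPartial_holds 1 t Ψ hΨ)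
    fun x => Finset.prod_nonneg fun p _ => localFactor_nonneg Ψ p
  have hM0 : 0 ≤ archFactor Ψ K * singularProduct Ψ := mul_nonneg (archFactor_nonneg Ψ K) hS0
  have hMB : archFactor Ψ K * singularProduct Ψ ≤ B₀ * Real.log (Real.log N) ^ (t - 1) * N := by
    have hGt : 0 ≤ Real.log (Real.log N) ^ (t - 1) * N :=
      mul_nonneg (pow_nonneg (zero_le_one.trans hG1) _) hN0.le
    calc archFactor Ψ K * singularProduct Ψ ≤ (2 * N) * (Cσ * Real.log (Real.log N) ^ (t - 1)) :=
          mul_le_mul (archFactor_le_two_mul Ψ hKN) (hσ N hNσ Ψ hΨ hL) hS0 (by positivity)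
      _ = 2 * Cσ * (Real.log (Real.log N) ^ (t - 1) * N) := by ring
      _ ≤ B₀ * (Real.log (Real.log N) ^ (t - 1) * N) := mul_le_mul_of_nonneg_right hB₀2 hGt
      _ = B₀ * Real.log (Real.log N) ^ (t - 1) * N := by ring
  have hsingΨ := fun i => (hsN N hNs u hu4 huA Ψ hΨ hL K hK hKN i).trans (add_le_add
    (mul_le_mul_of_nonneg_right (mul_le_mul_of_nonneg_right (mul_le_mul_of_nonneg_right hCs_le
      (Real.exp_pos _).le) hM0) (pow_nonneg (div_nonneg hu0 hℓ0.le) t)) le_rfl)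
  obtain ⟨θ, hθ0, hθ2, hθ⟩ := hlawN N hNlaw u (by omega) huA Ψ hΨ hL K hK hKN
  exact clipCells_pair Ψ K hN1 hu4 hℓ1 hL ((le_max_left _ _).trans hz) ((le_max_right _ _).trans hz)
    (le_max_right C_W 0) (fun θ' cc δ η' τ hδ hη' hτ hs h0 h2 h1 hl hn =>
      (hWt θ' cc δ η' τ hδ hη' hτ hs h0 h2 h1 hl hn).trans
        (mul_le_mul_of_nonneg_right (le_max_left _ _) (by positivity)))
    θ hθ0 hθ2 hθ (hnlcN N hNnlc u hu4 huA Ψ hΨ hL K hK hKN) hsingΨ (hidN N hN1' u hu4 huA) hcorner ha1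
    hsum hM0 hMB hη₀ hc_an hε_law.le hη.le hC_s hC₁ (Real.exp_pos _).le (Real.exp_pos _).le
    (hdec c hκc).1 (hdec c' hκc').1 (hdec c hκc).2 (hdec c' hκc').2 s₁ s₂ s₃ s₄ s₅ s₆ hε'c hεl2 r₁ r₂
    r₃ r₄ r₅ r₆ hlowc

end Summit.Parity.GeneralizedHardyLittlewood.Theorems.AbsoluteUpgrade

end
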